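import Mathlib
import Summits.Ventures.HodgeRepro2.T7SupportTwoTorusInvariant

/-!
# Tier7/Line3/KappaCongruence — the local congruence `hcong` of the isolation (seat t7-x1)

LINE 3 (t7-plan-3), the two-torus relative trace formula; the isolation of the regular double coset `γ₀` by a test
function of small support at the auxiliary inert place `v₁`. p1's `T7SupportIsolation` (row 666) and the
version-(ii) separation `ProductFormulaSeparation.inv_mul_pow_le_archSizeOn` both consume the hypothesis
`hcong : ∀ N γ, γ ∈ geomSupp N → abv (κ γ − κ γ₀) ≤ q⁻¹ ^ N` — «`κ` is constant to depth `N` on the support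
`T_A · γ₀ K_N · T_B` of `f_N`», `K_N = {k : k ≡ 1 mod ϖ^N}`. THIS FILE proves it in p1's coordinates
(`T7SupportTwoTorusInvariant`, row 662) over a field `E` with involution `σ` and a NON-ARCHIMEDEAN absolute value
`abv` (`E = E′_{v₁}`, `v₁` inert): if the entries of `k − 1` are `≤ ε` and the entries of `γ₀`, `f 0`, `d 0` are
`≤ M` (`M ≥ 1`, `ε ≤ 1`), then `abv (κ(γ₀ k) − κ(γ₀)) ≤ M⁶ ε / abv(d₀ d'₀)` — and the same for every `γ` in the
double coset `T_A (γ₀ k) T_B` by p1's invariance `kappa_diag_mul`. With `ε = q⁻¹ ^ N` this is `hcong` up to the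
constant `M⁶ / abv(d₀ d'₀)`, absorbed by a shift of `N`.

Pure algebra in the explicit model; nothing here is about an adelic group, an orbital integral or a period. Blind
lane: Mathlib + the HodgeRepro2 prefix only; no sorry; axioms ⊆ {propext, Classical.choice, Quot.sound}.
-/

namespace Summit.Ventures.HodgeRepro2.Tier7.Line3.KappaCongruence

open Summit.Ventures.HodgeRepro2.T7SupportTwoTorusInvariant Matrix

variable {E : Type*} [Field E] (σ : E →+* E) (abv : AbsoluteValue E ℝ)

/-- the ultrametric bound for a two-term sum. -/
theorem abv_add_le_max (hna : IsNonarchimedean abv) (x y : E) : abv (x + y) ≤ max (abv x) (abv y) :=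
  hna x y

/-- **the norm is ultrametrically Lipschitz**: `abv (N x − N y) ≤ abv (x − y) · max (abv x) (abv y)` when
`abv ∘ σ = abv`. -/
theorem abv_nrm_sub_nrm_le (hna : IsNonarchimedean abv) (hσ : ∀ x, abv (σ x) = abv x) (x y : E) :
    abv (nrm σ x - nrm σ y) ≤ abv (x - y) * max (abv x) (abv y) := by
  have h : nrm σ x - nrm σ y = (x - y) * σ x + y * σ (x - y) := by
    simp only [nrm, map_sub]; ring
  rw [h]
  refine (hna _ _).trans ?_
  rw [abv.map_mul, abv.map_mul, hσ, hσ]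
  refine max_le ?_ ?_
  · exact mul_le_mul_of_nonneg_left (le_max_left _ _) (abv.nonneg _)
  · rw [mul_comm]
    exact mul_le_mul_of_nonneg_left (le_max_right _ _) (abv.nonneg _)

/-- an entry of `(k − 1) *ᵥ v` is `≤ ε · M` when the entries of `k − 1` are `≤ ε` and those of `v` are `≤ M`. -/
theorem abv_mulVec_sub_one_le (hna : IsNonarchimedean abv) (k : Matrix (Fin 2) (Fin 2) E) (v : Fin 2 → E)
    {ε M : ℝ} (hε : 0 ≤ ε) (hk : ∀ i j, abv ((k - 1) i j) ≤ ε) (hv : ∀ i, abv (v i) ≤ M) (i : Fin 2) :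
    abv (((k - 1) *ᵥ v) i) ≤ ε * M := by
  rw [mulVec_two]
  refine (hna _ _).trans (max_le ?_ ?_)
  · rw [abv.map_mul]; exact mul_le_mul (hk i 0) (hv 0) (abv.nonneg _) hε
  · rw [abv.map_mul]; exact mul_le_mul (hk i 1) (hv 1) (abv.nonneg _) hε

/-- an entry of `γ *ᵥ w` is `≤ M · B` when the entries of `γ` are `≤ M` and those of `w` are `≤ B`. -/
theorem abv_mulVec_le (hna : IsNonarchimedean abv) (γ : Matrix (Fin 2) (Fin 2) E) (w : Fin 2 → E)
    {M B : ℝ} (hM : 0 ≤ M) (hγ : ∀ i j, abv (γ i j) ≤ M) (hw : ∀ i, abv (w i) ≤ B) (i : Fin 2) :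
    abv ((γ *ᵥ w) i) ≤ M * B := by
  rw [mulVec_two]
  refine (hna _ _).trans (max_le ?_ ?_)
  · rw [abv.map_mul]; exact mul_le_mul (hγ i 0) (hw 0) (abv.nonneg _) hM
  · rw [abv.map_mul]; exact mul_le_mul (hγ i 1) (hw 1) (abv.nonneg _) hM

/-- **the `(0,0)`-entry moves by at most `M³ ε`**: `abv (c₀₀(γ₀ k) − c₀₀(γ₀)) ≤ M³ ε`. -/
theorem abv_cc_mul_sub_cc_le (hna : IsNonarchimedean abv) (d : Fin 2 → E) (f : Fin 2 → Fin 2 → E)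
    (γ₀ k : Matrix (Fin 2) (Fin 2) E) {ε M : ℝ} (hε : 0 ≤ ε) (hM : 0 ≤ M)
    (hk : ∀ i j, abv ((k - 1) i j) ≤ ε) (hγ : ∀ i j, abv (γ₀ i j) ≤ M) (hf : ∀ i, abv (f 0 i) ≤ M)
    (hd : abv (d 0) ≤ M) :
    abv (cc d f (γ₀ * k) 0 0 - cc d f γ₀ 0 0) ≤ M ^ 3 * ε := by
  have h : cc d f (γ₀ * k) 0 0 - cc d f γ₀ 0 0 = d 0 * ((γ₀ *ᵥ ((k - 1) *ᵥ f 0)) 0) := by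
    simp only [cc]
    rw [← Matrix.mulVec_mulVec, Matrix.sub_mulVec, Matrix.one_mulVec, Matrix.mulVec_sub, Pi.sub_apply]
    ring
  rw [h, abv.map_mul]
  have h1 : abv ((γ₀ *ᵥ ((k - 1) *ᵥ f 0)) 0) ≤ M * (ε * M) :=
    abv_mulVec_le abv hna γ₀ _ hM hγ (fun i => abv_mulVec_sub_one_le abv hna k (f 0) hε hk hf i) 0
  calc abv (d 0) * abv ((γ₀ *ᵥ ((k - 1) *ᵥ f 0)) 0) ≤ M * (M * (ε * M)) :=
        mul_le_mul hd h1 (abv.nonneg _) hM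
    _ = M ^ 3 * ε := by ring

/-- the `(0,0)`-entry itself is `≤ M³`. -/
theorem abv_cc_le (hna : IsNonarchimedean abv) (d : Fin 2 → E) (f : Fin 2 → Fin 2 → E)
    (γ₀ : Matrix (Fin 2) (Fin 2) E) {M : ℝ} (hM : 0 ≤ M)
    (hγ : ∀ i j, abv (γ₀ i j) ≤ M) (hf : ∀ i, abv (f 0 i) ≤ M) (hd : abv (d 0) ≤ M) :
    abv (cc d f γ₀ 0 0) ≤ M ^ 3 := by
  simp only [cc]
  rw [abv.map_mul]
  have h1 : abv ((γ₀ *ᵥ f 0) 0) ≤ M * M := abv_mulVec_le abv hna γ₀ (f 0) hM hγ hf 0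
  calc abv (d 0) * abv ((γ₀ *ᵥ f 0) 0) ≤ M * (M * M) := mul_le_mul hd h1 (abv.nonneg _) hM
    _ = M ^ 3 := by ring

/-- **the local congruence**: `abv (κ(γ₀ k) − κ(γ₀)) ≤ M⁶ ε / abv (d₀ d'₀)` for `k ≡ 1` to precision `ε ≤ 1`
and `γ₀`, `f 0`, `d 0` of size `≤ M`, `M ≥ 1`. -/
theorem abv_kappa_mul_sub_kappa_le (hna : IsNonarchimedean abv) (hσ : ∀ x, abv (σ x) = abv x)
    (d : Fin 2 → E) (f : Fin 2 → Fin 2 → E) (γ₀ k : Matrix (Fin 2) (Fin 2) E)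
    {ε M : ℝ} (hε : 0 ≤ ε) (hε1 : ε ≤ 1) (hM : 1 ≤ M)
    (hk : ∀ i j, abv ((k - 1) i j) ≤ ε) (hγ : ∀ i j, abv (γ₀ i j) ≤ M) (hf : ∀ i, abv (f 0 i) ≤ M)
    (hd : abv (d 0) ≤ M) :
    abv (kappa σ d f (γ₀ * k) - kappa σ d f γ₀) ≤ M ^ 6 * ε / abv (d 0 * disc' σ d f 0) := by
  have hM0 : 0 ≤ M := zero_le_one.trans hM
  set c := cc d f (γ₀ * k) 0 0 with hc
  set c₀ := cc d f γ₀ 0 0 with hc₀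
  have hdiff : abv (c - c₀) ≤ M ^ 3 * ε := abv_cc_mul_sub_cc_le abv hna d f γ₀ k hε hM0 hk hγ hf hd
  have hc₀le : abv c₀ ≤ M ^ 3 := abv_cc_le abv hna d f γ₀ hM0 hγ hf hd
  have hcle : abv c ≤ M ^ 3 := by
    have : c = (c - c₀) + c₀ := by ring
    rw [this]
    refine (hna _ _).trans (max_le ?_ hc₀le)
    refine hdiff.trans ?_
    have : M ^ 3 * ε ≤ M ^ 3 * 1 := mul_le_mul_of_nonneg_left hε1 (by positivity)
    linarith
  have hnrm : abv (nrm σ c - nrm σ c₀) ≤ M ^ 6 * ε := by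
    refine (abv_nrm_sub_nrm_le σ abv hna hσ c c₀).trans ?_
    calc abv (c - c₀) * max (abv c) (abv c₀) ≤ (M ^ 3 * ε) * M ^ 3 :=
          mul_le_mul hdiff (max_le hcle hc₀le) (le_max_of_le_left (abv.nonneg _)) (by positivity)
      _ = M ^ 6 * ε := by ring
  have hκ : kappa σ d f (γ₀ * k) - kappa σ d f γ₀ = (nrm σ c - nrm σ c₀) / (d 0 * disc' σ d f 0) := by
    simp only [kappa, hc, hc₀]
    rw [sub_div]
  rw [hκ, map_div₀ abv]
  by_cases hden : abv (d 0 * disc' σ d f 0) = 0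
  · rw [hden, div_zero, div_zero]
  · have hpos : 0 < abv (d 0 * disc' σ d f 0) := lt_of_le_of_ne (abv.nonneg _) (Ne.symm hden)
    exact div_le_div_of_nonneg_right hnrm hpos.le

/-- **the congruence on the whole double coset**: for `γ = diagonal a * (γ₀ k) * t'` with `N(a 0) = N(b 0) = 1`
and `t'` acting on the second basis by `b` (`T_A (γ₀ k) T_B`), the same bound holds — p1's invariance
`kappa_diag_mul`. -/
theorem abv_kappa_sub_kappa_le_of_double_coset (hna : IsNonarchimedean abv) (hσ : ∀ x, abv (σ x) = abv x)
    (d : Fin 2 → E) (f : Fin 2 → Fin 2 → E) (γ₀ k t' : Matrix (Fin 2) (Fin 2) E) (a b : Fin 2 → E)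
    (ha : nrm σ (a 0) = 1) (hb0 : nrm σ (b 0) = 1) (hb : ActsOn f t' b)
    {ε M : ℝ} (hε : 0 ≤ ε) (hε1 : ε ≤ 1) (hM : 1 ≤ M)
    (hk : ∀ i j, abv ((k - 1) i j) ≤ ε) (hγ : ∀ i j, abv (γ₀ i j) ≤ M) (hf : ∀ i, abv (f 0 i) ≤ M)
    (hd : abv (d 0) ≤ M) :
    abv (kappa σ d f (diagonal a * (γ₀ * k) * t') - kappa σ d f γ₀) ≤
      M ^ 6 * ε / abv (d 0 * disc' σ d f 0) := by
  rw [kappa_diag_mul σ d f (γ₀ * k) t' a b ha hb0 hb]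
  exact abv_kappa_mul_sub_kappa_le σ abv hna hσ d f γ₀ k hε hε1 hM hk hγ hf hd

/-- **`hcong` in depth form**: with `ε = q⁻¹ ^ N` (`q > 1`) and the constant `C := M⁶ / abv(d₀ d'₀)`,
`abv (κ(γ₀ k) − κ(γ₀)) ≤ C · q⁻¹ ^ N`. -/
theorem abv_kappa_mul_sub_kappa_le_pow (hna : IsNonarchimedean abv) (hσ : ∀ x, abv (σ x) = abv x)
    (d : Fin 2 → E) (f : Fin 2 → Fin 2 → E) (γ₀ k : Matrix (Fin 2) (Fin 2) E)
    {q M : ℝ} (hq : 1 < q) (N : ℕ) (hM : 1 ≤ M)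
    (hk : ∀ i j, abv ((k - 1) i j) ≤ q⁻¹ ^ N) (hγ : ∀ i j, abv (γ₀ i j) ≤ M) (hf : ∀ i, abv (f 0 i) ≤ M)
    (hd : abv (d 0) ≤ M) :
    abv (kappa σ d f (γ₀ * k) - kappa σ d f γ₀) ≤ (M ^ 6 / abv (d 0 * disc' σ d f 0)) * q⁻¹ ^ N := by
  have hq0 : 0 < q := zero_lt_one.trans hq
  have hε : 0 ≤ q⁻¹ ^ N := by positivity
  have hε1 : q⁻¹ ^ N ≤ 1 := pow_le_one₀ (by positivity) (inv_le_one_of_one_le₀ hq.le)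
  have h := abv_kappa_mul_sub_kappa_le σ abv hna hσ d f γ₀ k hε hε1 hM hk hγ hf hd
  refine h.trans (le_of_eq ?_)
  ring

end Summit.Ventures.HodgeRepro2.Tier7.Line3.KappaCongruence
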